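import Literature.MathematicalPhysics.QuantumLattice.HubbardTTPrimeGrandCanonicalEnsembleEquivalence
import Literature.MathematicalPhysics.QuantumLattice.HubbardTTPrimeThermalPressureDensityBand
import HarnessLib

/-!
# The chemical potential of the 2D `t–t'` Hubbard model at every temperature lies in the lattice-gas band:
# `β⁻¹ log(n/(2−n)) − (4|t|+4|t'|) ≤ μ ≤ β⁻¹ log(n/(2−n)) + 4|t|+4|t'| + U`

Topic `MathematicalPhysics/QuantumLattice` (family `hubbard`); the junction of
`HubbardTTPrimeGrandCanonicalEnsembleEquivalence.lean` (for `β > 0` and `0 < n < 2` there is a chemical potential `μ`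
with `pressureTT' n + βμn = P(μ)`, i.e. the density `n` attains the Legendre supremum at `μ`) and
`HubbardTTPrimeThermalPressureDensityBand.lean` (the sharp density slopes of `pressureTT'` from the volume-free transfer:
`(y−x)(log((2−y)/y) − βκ₊) ≤ p(y) − p(x) ≤ (y−x)(log((2−x)/x) + βκ₋)`, `κ₊ = 4|t|+4|t'|+U`, `κ₋ = 4|t|+4|t'|`).
A chemical potential `μ` ATTAINED by the density `n` (`pressureTT' n + βμn = gcPressureTT' μ`) is a supergradient of
the concave `p` at `n` (slope `−βμ`), so it is squeezed between the chord slopes on either side: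

* `log_sub_le_neg_attained_mul` / `neg_attained_mul_le_log_add` — for every `y ∈ (n, 2)`:
  `log((2−y)/y) − βκ₊ ≤ −βμ`, and for every `x ∈ (0, n)`: `−βμ ≤ log((2−x)/x) + βκ₋`;
* **`chemicalPotential_mem_band`** — letting `x, y → n`:
  `log(n/(2−n)) − β(4|t|+4|t'|) ≤ βμ ≤ log(n/(2−n)) + β(4|t|+4|t'|+U)`;
* `exists_chemicalPotential_mem_band` — with the existence from the ensemble equivalence: for `β > 0`, `U ≥ 0`,
  `0 < n < 2` there IS such a `μ`, and every such `μ` lies in the band.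

At half filling `n = 1` the band is `[−(4|t|+4|t'|), 4|t|+4|t'|+U]` at every temperature; as `β → ∞` the entropy term
`β⁻¹ log(n/(2−n))` disappears and the band is the `T = 0` one (bottom of the band … top of the band plus `U`).

Everything is PROVED; no definition, no named fact.

## Mathlib / tree search

REUSED: `exists_chemicalPotential_pressureTT'_eq`, `pressureTT'_add_le_gcPressureTT'` (`…EnsembleEquivalence`,
`…GrandCanonicalPressure`), `density_mul_le_pressureTT'_sub_local`, `pressureTT'_sub_le_density_mul_local`
(`…ThermalPressureDensityBand`), Mathlib `Real.continuousAt_log`, `ContinuousAt.tendsto`, `tendsto_nhdsWithin_of_tendsto_nhds`,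
`ge_of_tendsto`, `le_of_tendsto`. `lean search 'chemicalPotential_mem|mem_band'`: nothing (2026-08-27).

## References

* D. Ruelle, *Statistical Mechanics: Rigorous Results* (1969), §3.4. [cite: Ruelle1969, §3.4]
* R. B. Israel, *Convexity in the Theory of Lattice Gases* (1979), Thm. I.2.4. [cite: Israel1979, Thm. I.2.4]
-/

noncomputable section

namespace Literature.MathematicalPhysics.QuantumLattice

open Matrix Finset HubbardWave0 Literature.Probability.LatticeModels LiebThm1
open _root_.Filter
open scoped _root_.Topology ComplexOrder BigOperators

namespace ThermodynamicLimit

/-- `x ↦ log((2 − x)/x)` is continuous at every `n ∈ (0, 2)`. [folklore] -/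
private theorem continuousAt_log_band {n : ℝ} (hn0 : 0 < n) (hn2 : n < 2) :
    ContinuousAt (fun x : ℝ => Real.log ((2 - x) / x)) n := by
  have h1 : ContinuousAt (fun x : ℝ => (2 - x) / x) n :=
    ((continuousAt_const.sub continuousAt_id).div continuousAt_id hn0.ne')
  exact h1.log (div_pos (by linarith) hn0).ne'

section Band

variable {β : ℝ} (hβ : 0 ≤ β) (t t' : ℝ) {U : ℝ} (hU : 0 ≤ U)
include hβ hU

/-- **Upper chord**: if `n` attains the Legendre supremum at `μ`, then for every `y ∈ (n, 2)`:
`log((2−y)/y) − β(4|t|+4|t'|+U) ≤ −βμ`. [cite: Ruelle1969, §3.4] -/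
theorem log_sub_le_neg_attained_mul {μ n y : ℝ} (hn0 : 0 ≤ n) (hny : n < y) (hy2 : y < 2)
    (heq : pressureTT' β t t' U n + β * μ * n = gcPressureTT' β t t' U μ) :
    Real.log ((2 - y) / y) - β * (4 * |t| + 4 * |t'| + U) ≤ -(β * μ) := by
  have hy0 : 0 < y := lt_of_le_of_lt hn0 hny
  have h1 := density_mul_le_pressureTT'_sub_local hβ t t' hU hn0 hny.le hy0 hy2
  have h2 := pressureTT'_add_le_gcPressureTT' hβ t t' hU μ hy0.le hy2
  -- `p(y) − p(n) ≤ −βμ (y − n)` and `(y − n)(log − κ₊) ≤ p(y) − p(n)`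
  have h3 : (y - n) * (Real.log ((2 - y) / y) - β * (4 * |t| + 4 * |t'| + U)) ≤ (y - n) * (-(β * μ)) := by
    nlinarith [h1, h2, heq]
  exact le_of_mul_le_mul_left (by linarith [h3]) (sub_pos.2 hny)

/-- **Lower chord**: if `n` attains the Legendre supremum at `μ`, then for every `x ∈ (0, n)`:
`−βμ ≤ log((2−x)/x) + β(4|t|+4|t'|)`. [cite: Ruelle1969, §3.4] -/
theorem neg_attained_mul_le_log_add {μ n x : ℝ} (hx0 : 0 < x) (hxn : x < n) (hn2 : n < 2)
    (heq : pressureTT' β t t' U n + β * μ * n = gcPressureTT' β t t' U μ) :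
    -(β * μ) ≤ Real.log ((2 - x) / x) + β * (4 * |t| + 4 * |t'|) := by
  have h1 := pressureTT'_sub_le_density_mul_local hβ t t' hU hx0 hxn.le hn2
  have h2 := pressureTT'_add_le_gcPressureTT' hβ t t' hU μ hx0.le (hxn.trans hn2)
  have h3 : (n - x) * (-(β * μ)) ≤ (n - x) * (Real.log ((2 - x) / x) + β * (4 * |t| + 4 * |t'|)) := by
    nlinarith [h1, h2, heq]
  exact le_of_mul_le_mul_left (by linarith [h3]) (sub_pos.2 hxn)

/-- **The chemical-potential band at every temperature.** If the density `n ∈ (0,2)` attains the Legendre supremum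
at `μ` (`pressureTT' n + βμn = gcPressureTT' μ`), then
`log(n/(2−n)) − β(4|t|+4|t'|) ≤ βμ ≤ log(n/(2−n)) + β(4|t|+4|t'|+U)`: the ideal lattice-gas chemical potential plus a
one-particle energy between the bottom of the band and the top of the band plus `U`. [cite: Ruelle1969, §3.4]
[cite: Israel1979, Thm. I.2.4] -/
theorem chemicalPotential_mem_band {μ n : ℝ} (hn0 : 0 < n) (hn2 : n < 2)
    (heq : pressureTT' β t t' U n + β * μ * n = gcPressureTT' β t t' U μ) :
    Real.log (n / (2 - n)) - β * (4 * |t| + 4 * |t'|) ≤ β * μ ∧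
      β * μ ≤ Real.log (n / (2 - n)) + β * (4 * |t| + 4 * |t'| + U) := by
  have hlogn : Real.log (n / (2 - n)) = -Real.log ((2 - n) / n) := by
    rw [← Real.log_inv, inv_div]
  have hcont := continuousAt_log_band hn0 hn2
  constructor
  · -- from the lower chords `−βμ ≤ log((2−x)/x) + βκ₋`, `x ↑ n`
    have hlim : Tendsto (fun x : ℝ => Real.log ((2 - x) / x) + β * (4 * |t| + 4 * |t'|)) (𝓝[Set.Ioo 0 n] n)
        (𝓝 (Real.log ((2 - n) / n) + β * (4 * |t| + 4 * |t'|))) :=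
      tendsto_nhdsWithin_of_tendsto_nhds ((hcont.tendsto).add tendsto_const_nhds)
    haveI : (𝓝[Set.Ioo 0 n] n).NeBot := by
      rw [← mem_closure_iff_nhdsWithin_neBot, closure_Ioo hn0.ne]; exact ⟨hn0.le, le_rfl⟩
    have h := ge_of_tendsto hlim (eventually_nhdsWithin_of_forall fun x hx =>
      neg_attained_mul_le_log_add hβ t t' hU hx.1 hx.2 hn2 heq)
    rw [hlogn]; linarith
  · -- from the upper chords `log((2−y)/y) − βκ₊ ≤ −βμ`, `y ↓ n`
    have hlim : Tendsto (fun y : ℝ => Real.log ((2 - y) / y) - β * (4 * |t| + 4 * |t'| + U)) (𝓝[Set.Ioo n 2] n)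
        (𝓝 (Real.log ((2 - n) / n) - β * (4 * |t| + 4 * |t'| + U))) :=
      tendsto_nhdsWithin_of_tendsto_nhds ((hcont.tendsto).sub tendsto_const_nhds)
    haveI : (𝓝[Set.Ioo n 2] n).NeBot := by
      rw [← mem_closure_iff_nhdsWithin_neBot, closure_Ioo hn2.ne]; exact ⟨le_rfl, hn2.le⟩
    have h := le_of_tendsto hlim (eventually_nhdsWithin_of_forall fun y hy =>
      log_sub_le_neg_attained_mul hβ t t' hU hn0.le hy.1 hy.2 heq)
    rw [hlogn]; linarith

/-- **Existence and location of the chemical potential** (`β > 0`, `U ≥ 0`, `0 < n < 2`): there is a `μ` with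
`pressureTT' n + βμn = P(μ)`, and every such `μ` satisfies
`β⁻¹ log(n/(2−n)) − (4|t|+4|t'|) ≤ μ ≤ β⁻¹ log(n/(2−n)) + 4|t|+4|t'| + U`. [cite: Ruelle1969, §3.4]
[cite: Israel1979, Thm. I.2.4] -/
theorem exists_chemicalPotential_mem_band (hβ' : 0 < β) {n : ℝ} (hn0 : 0 < n) (hn2 : n < 2) :
    (∃ μ : ℝ, pressureTT' β t t' U n + β * μ * n = gcPressureTT' β t t' U μ) ∧
      ∀ μ : ℝ, pressureTT' β t t' U n + β * μ * n = gcPressureTT' β t t' U μ →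
        Real.log (n / (2 - n)) / β - (4 * |t| + 4 * |t'|) ≤ μ ∧
          μ ≤ Real.log (n / (2 - n)) / β + (4 * |t| + 4 * |t'| + U) := by
  refine ⟨?_, fun μ heq => ?_⟩
  · obtain ⟨μ, hμ⟩ := exists_chemicalPotential_pressureTT'_eq hβ t t' hU hβ' hn0 hn2
    exact ⟨μ, by linarith⟩
  · obtain ⟨h1, h2⟩ := chemicalPotential_mem_band hβ t t' hU hn0 hn2 heq
    constructor
    · rw [div_sub' (hc := hβ'.ne'), div_le_iff₀ hβ']
      linarith
    · rw [div_add' _ _ _ hβ'.ne', le_div_iff₀ hβ']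
      linarith

end Band

end ThermodynamicLimit

end Literature.MathematicalPhysics.QuantumLattice
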